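import Summits.QuantumFields.YangMills.Theorems.BalabanUVNodesK2CornerRoadLine2W
import Summits.QuantumFields.YangMills.Theorems.BalabanUVNodesK1R9BodyAtRevisedRecordWorldOfNodesWRunLetters

/-!
# Route `BalabanUVNodes` rev 29 — K1⁹ BY NAME ON K1 «v10» LINE 2′ from the corner road ∕ the row-mass road (hypothesis form; 0 `def`, 0 `sorry`)

Cell `ym-nodeO-ideate`, PROVER seat `ym-nodeO-port-1` (gen 5).  The last link of the LINE-2′ port: p636268 `…K2CornerRoadLine2W` lands the REGISTERED v10 stub signatures `stub_runRows13PWSVW` ∕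
`stub_cont13VW` under displayed letters; dag-n24-c g12's `…K1R9BodyAtRevisedRecordWorldOfNodesWRunLetters` (p638487) lands the window-guarded END road and the LINE-2′ composition BY NAME
(`stabilityBRunRowsAtRecordR13SepCoPHV_of_stubTextsVW`, `…_byName_of_rowsContWitnessVW`).  Composing the two: the DECIDING crux K1⁹ `…Theses.BalabanUVNodes.StabilityBRunRowsAtRecordR13SepCoPHV`
(stmt-QuantumFields-27364) BY NAME from {the REGISTERED stub 1ⱽᵂ text, N11CU IN-WINDOW at the slot world, U3ᴷ-lite + anchor + positive drift} (corner road) or {…, the ∀θ row-mass-runs letter}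
(row-mass road), and the two ∃-side producers (ceiling-keyed guarded rung 1ⱽᵂ + letters AT THE WITNESS).  Helper keyed `--supports stmt-QuantumFields-27364 --as helper`; count-neutral; NO skeleton
registered or re-keyed; nothing of dag-n24-c ∕ n13-w3 ∕ DEF-1 restated.

HONEST FRAMING.  Three-line compositions of landed doors over displayed HYPOTHESIS SHAPES; NOTHING of Bałaban asserted or discharged; inhabitation of the letters NOT claimed; no stub proved or
closed; K1⁹ OPEN (v10 0∕6); counts unmoved (typed 28∕28 · discharged 5∕27 (A 5∕28)); [Balaban1987RG1] Thm 2 + (0.31) p. 259 and §1's continuity unproved in print; R4 = the CONDITIONAL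
finite-𝕋⁴ rung `BalabanLadder.UV` only — NOT ℝ⁴, NOT OS, NOT the Yang–Mills mass gap, NOT Clay.  No `def`, no `instance`, no `notation`, no `axiom`.
-/

noncomputable section

open scoped Matrix.Norms.L2Operator

namespace Summit.QuantumFields.YangMills.Theorems.BalabanUVNodesK2CornerRoadLine2WK19

open Literature.MathematicalPhysics.QuantumFieldTheory.Balaban1983to89
open Literature.MathematicalPhysics.QuantumFieldTheory.Balaban1983to89.T4Continuum
open Literature.MathematicalPhysics.QuantumFieldTheory.Balaban1983to89.DagBinding
open Literature.MathematicalPhysics.QuantumFieldTheory.Balaban1983to89.FlowStep (HBeta prefixOf RGEqH)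
open Literature.MathematicalPhysics.QuantumFieldTheory.Balaban1983to89.T4CouplingMatching (HistLipschitz)
open Literature.MathematicalPhysics.QuantumFieldTheory.Balaban1983to89.Beta.Drift (OneLoopDrift)
open Summit.QuantumFields.YangMills.Theorems.BalabanUVNodesK2NamedJetsRemAt (ScaleAnchor)
open Summit.QuantumFields.YangMills.Theorems.K1V6Defs (Inhabited13)
open Summit.QuantumFields.YangMills.Theorems.K1V9Defs (RecordSV)
open Summit.QuantumFields.YangMills.Theorems.K1V10Defs (NodesAtSomeRecord13PWSVW RunRowsAtSomeRecord13PWSVW RunRowsContAtSomeRecord13PWSVW)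
open Summit.QuantumFields.YangMills.Theses.BalabanUVNodes (StabilityBRunRowsAtRecordR13SepCoPHV)
open Summit.QuantumFields.YangMills.Theorems.BalabanUVNodesK2CornerRoadLine2W
open Summit.QuantumFields.YangMills.BalabanUVNodes.K1R9BodyAtRevisedRecordWorldOfNodesWRunLetters
  (stabilityBRunRowsAtRecordR13SepCoPHV_of_stubTextsVW stabilityBRunRowsAtRecordR13SepCoPHV_byName_of_rowsContWitnessVW)

/-- **★★ K1⁹ BY NAME ON LINE 2′ FROM THE REGISTERED STUB 1ⱽᵂ TEXT + N11CU IN-WINDOW AT THE SLOT WORLD + THE TWO ∀θ CORNER LETTERS** (dag-n24-c g12's `…_of_stubTextsVW` over p636268 §2∕§4: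
`h₂` = `stub_runRows13PWSVW`'s text from {N11CUᵂ, U3ᴷ-lite moduli-with-mass, anchor + POSITIVE drift}; `h₃` = `stub_cont13VW`'s text from U3ᴷ-lite's MODULI ALONE on the box `]0, θ.γ]`
(`θ.γ > 0` by admissibility)).  THE LINE-2′ LEDGER OF THE CORNER ROAD: stub 2ⱽᵂ ⟸ {N11CU in-window (ONE node), moduli-with-mass, `ScaleAnchor` + `OneLoopDrift s A b` with `0 < s`}; stub 3ⱽᵂ ⟸
{moduli}; stub 1ⱽᵂ = N13 ∕ engine lanes (untouched).  CONDITIONAL on four displayed texts (none supplied here); K1⁹ NOT closed; no stub proved; nothing of Bałaban asserted; no count moved.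
[cite: Balaban1988Convergent, Thm 1 p.262, (2.6) p.255, Cor. 3 (2.50) p.264; Balaban1989LargeFieldI, (1.2) p.178; Balaban1989LargeFieldII, Thm 1 p.355 and (0.1) pp.355-356; Balaban1987RG1, (0.20) p.256, Thm 2 p.259 (first sentence), Thm 3 p.264, (2.12)-(2.14) p.268, (5.10) p.293, §1 pp.263-264 and §5 p.298] -/
theorem stabilityBRunRowsAtRecordR13SepCoPHV_of_stub1VWText_n11CUVW_liteText_cornerText
    (h₁ : ∀ F : T4Family, Inhabited13 F → NodesAtSomeRecord13PWSVW F)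
    (hN11VW : ∀ (F : T4Family) (θ : Node00.Stage13HParams F 2) (h : θ.Provisos₁₃SepCoPH F 2) (v : Node00.Revision₁₃ F 2 θ h) (w : WorldP),
      (θ.ZhUnity F 2 ∧ θ.SlotsNondegenerate₁₃ F 2) → θ.Admissible F 2 → RecordSV F θ h v w → (∀ P : B12.RunParams, (leavesP w P).smallCouplings → Nodes (leavesP w P)) →
      ∀ c : ℝ, ∃ γ' : ℝ, 0 < γ' ∧ γ' ≤ w.γ ∧ ∀ P : B12.RunParams,
        (leavesP { w with βup := c, γ := γ' } P).smallCouplings → Dag.B14_main (leavesP { w with βup := c, γ := γ' } P))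
    (hLite : ∀ (F : T4Family) (θ : Node00.Stage13HParams F 2), θ.Provisos₁₃SepCoPH F 2 → (θ.ZhUnity F 2 ∧ θ.SlotsNondegenerate₁₃ F 2) → θ.Admissible F 2 →
      ∃ (Λ : ℕ → ℕ → ℝ) (M : ℝ), HistLipschitz Λ θ.γ (Node00.betaOfRecord₁₃ F 2 θ.toStage13Params) ∧ ∀ k, ∑ i : Fin (k + 1), |Λ k i| ≤ M)
    (hCD : ∀ (F : T4Family) (θ : Node00.Stage13HParams F 2), θ.Provisos₁₃SepCoPH F 2 → (θ.ZhUnity F 2 ∧ θ.SlotsNondegenerate₁₃ F 2) → θ.Admissible F 2 →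
      ∃ (b : ℕ → ℝ) (s A : ℝ), ScaleAnchor (Node00.betaOfRecord₁₃ F 2 θ.toStage13Params) b ∧ 0 < s ∧ OneLoopDrift s A b) :
    StabilityBRunRowsAtRecordR13SepCoPHV :=
  stabilityBRunRowsAtRecordR13SepCoPHV_of_stubTextsVW h₁ (stub_runRows13PWSVWText_of_n11CUVW_liteText_cornerText hN11VW hLite hCD)
    (stub_cont13VWText_of_boxModuli fun F θ hP hU hθ => by
      obtain ⟨Λ, -, hL, -⟩ := hLite F θ hP hU hθ
      exact ⟨θ.γ, Λ, hθ.toStage12.toStage9.gamma_pos, hL⟩)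

/-- **★★ K1⁹ BY NAME ON LINE 2′ FROM THE REGISTERED STUB 1ⱽᵂ TEXT + N11CU IN-WINDOW + THE ∀θ ROW-MASS-RUNS LETTER** (the row-mass road; `h₃` from the letter's moduli on their own box):
stub 2ⱽᵂ ⟸ {N11CU in-window, U3ᴷ-lite moduli WITH ROW MASS, (α♭) one lower-(0.31) run of `β_θ` per depth (which CARRIES the pointwise sign datum, p635201 §1b)}; stub 3ⱽᵂ ⟸ {moduli}.
ANCHOR-FREE, DRIFT-FREE, FADING-FREE.  CONDITIONAL on three displayed texts (none supplied here); K1⁹ NOT closed; no stub proved; nothing of Bałaban asserted; no count moved.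
[cite: Balaban1988Convergent, Thm 1 p.262, (2.6) p.255, Cor. 3 (2.50) p.264; Balaban1989LargeFieldI, (1.2) p.178; Balaban1989LargeFieldII, Thm 1 p.355 and (0.1) pp.355-356; Balaban1987RG1, (0.20) p.256, Thm 2 (0.31) p.259, Thm 3 p.264, (2.12)-(2.14) p.268, (5.10) p.293, §5 p.298] -/
theorem stabilityBRunRowsAtRecordR13SepCoPHV_of_stub1VWText_n11CUVW_rowMassRunsText
    (h₁ : ∀ F : T4Family, Inhabited13 F → NodesAtSomeRecord13PWSVW F)
    (hN11VW : ∀ (F : T4Family) (θ : Node00.Stage13HParams F 2) (h : θ.Provisos₁₃SepCoPH F 2) (v : Node00.Revision₁₃ F 2 θ h) (w : WorldP),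
      (θ.ZhUnity F 2 ∧ θ.SlotsNondegenerate₁₃ F 2) → θ.Admissible F 2 → RecordSV F θ h v w → (∀ P : B12.RunParams, (leavesP w P).smallCouplings → Nodes (leavesP w P)) →
      ∀ c : ℝ, ∃ γ' : ℝ, 0 < γ' ∧ γ' ≤ w.γ ∧ ∀ P : B12.RunParams,
        (leavesP { w with βup := c, γ := γ' } P).smallCouplings → Dag.B14_main (leavesP { w with βup := c, γ := γ' } P))
    (hRM : ∀ (F : T4Family) (θ : Node00.Stage13HParams F 2), θ.Provisos₁₃SepCoPH F 2 → θ.Admissible F 2 →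
      ∃ (γ L s s' : ℝ) (Λ : ℕ → ℕ → ℝ), HistLipschitz Λ γ (Node00.betaOfRecord₁₃ F 2 θ.toStage13Params) ∧ (∀ k, ∑ i : Fin (k + 1), |Λ k i| ≤ L) ∧ 0 < γ ∧ 0 < s ∧
        ∀ K : ℕ, ∃ r : ℕ → ℝ, RGEqH K (Node00.betaOfRecord₁₃ F 2 θ.toStage13Params) r ∧ Step.InInterval γ K r ∧ Step.Discrete031 s s' K (r K) r) :
    StabilityBRunRowsAtRecordR13SepCoPHV :=
  stabilityBRunRowsAtRecordR13SepCoPHV_of_stubTextsVW h₁ (stub_runRows13PWSVWText_of_n11CUVW_rowMassRunsText hN11VW hRM)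
    (stub_cont13VWText_of_boxModuli fun F θ hP _hU hθ => by
      obtain ⟨γ, -, -, -, Λ, hL, -, hγ, -, -⟩ := hRM F θ hP hθ
      exact ⟨γ, Λ, hγ, hL⟩)

/-- **★★ K1⁹ BY NAME ON LINE 2′, ∃-SIDE, CORNER ROAD** (letters AT THE WITNESS; dag-n24-c g12's `…_byName_of_rowsContWitnessVW` over p636268 §2): for every family with a unity Stage-13 tuple,
SOME unity admissible `(θ, h)`, SOME slot `v`, a GUARDED ceiling-keyed family of `RecordSV` worlds with the thirteen nodes IN-WINDOW, U3ᴷ-lite moduli-with-mass for `β_θ` and an anchor with a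
POSITIVE drift ⟹ `…Theses.BalabanUVNodes.StabilityBRunRowsAtRecordR13SepCoPHV`.  CONDITIONAL on `hprod` (not supplied here); K1⁹ NOT closed; nothing of Bałaban asserted; no count moved.
[cite: Balaban1988Convergent, Thm 1 p.262, Cor. 3 (2.50) p.264; Balaban1989LargeFieldI, (1.2) p.178; Balaban1989LargeFieldII, Thm 1 p.355 and (0.1) pp.355-356; Balaban1987RG1, (0.20) p.256, Thm 2 p.259 (first sentence), Thm 3 p.264, (2.12)-(2.14) p.268, (5.10) p.293, §1 pp.263-264 and §5 p.298] -/
theorem stabilityBRunRowsAtRecordR13SepCoPHV_of_ceilingKeyedRung1VWWithMassBandCornerLetters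
    (hprod : ∀ F : T4Family, Inhabited13 F →
      ∃ (θ : Node00.Stage13HParams F 2) (h : θ.Provisos₁₃SepCoPH F 2) (v : Node00.Revision₁₃ F 2 θ h), (θ.ZhUnity F 2 ∧ θ.SlotsNondegenerate₁₃ F 2) ∧ θ.Admissible F 2 ∧
        (∀ c : ℝ, ∃ w : WorldP, c ≤ w.βup ∧ RecordSV F θ h v w ∧ ∀ P : B12.RunParams, (leavesP w P).smallCouplings → Nodes (leavesP w P)) ∧
        (∃ (Λ : ℕ → ℕ → ℝ) (M : ℝ), HistLipschitz Λ θ.γ (Node00.betaOfRecord₁₃ F 2 θ.toStage13Params) ∧ ∀ k, ∑ i : Fin (k + 1), |Λ k i| ≤ M) ∧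
        ∃ (b : ℕ → ℝ) (s A : ℝ), ScaleAnchor (Node00.betaOfRecord₁₃ F 2 θ.toStage13Params) b ∧ 0 < s ∧ OneLoopDrift s A b) :
    StabilityBRunRowsAtRecordR13SepCoPHV :=
  stabilityBRunRowsAtRecordR13SepCoPHV_byName_of_rowsContWitnessVW fun F hinh => by
    obtain ⟨θ, hP, v, hU, hθ, hfamW, ⟨Λ, M, hL, hM⟩, b, s, A, hb, hs, hdrift⟩ := hprod F hinh
    exact runRowsContAtSomeRecord13PWSVW_of_ceilingKeyedRung1VW_cornerLetters θ hP v hU hθ hfamW hL hM hb hs hdrift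

/-- **★★ K1⁹ BY NAME ON LINE 2′, ∃-SIDE, ROW-MASS ROAD** (letters AT THE WITNESS; over p636268 §3): SOME unity admissible `(θ, h)`, SOME slot `v`, a GUARDED ceiling-keyed family of `RecordSV` worlds
with the nodes in-window, U3ᴷ-lite moduli-with-row-mass for `β_θ` and ONE lower-(0.31) run of `β_θ` per depth ⟹ `…Theses.BalabanUVNodes.StabilityBRunRowsAtRecordR13SepCoPHV`.  ANCHOR-FREE, DRIFT-FREE.
CONDITIONAL on `hprod` (not supplied here); K1⁹ NOT closed; nothing of Bałaban asserted; no count moved.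
[cite: Balaban1988Convergent, Thm 1 p.262, Cor. 3 (2.50) p.264; Balaban1989LargeFieldI, (1.2) p.178; Balaban1989LargeFieldII, Thm 1 p.355 and (0.1) pp.355-356; Balaban1987RG1, (0.20) p.256, Thm 2 (0.31) p.259, Thm 3 p.264, (2.12)-(2.14) p.268, (5.10) p.293, §5 p.298] -/
theorem stabilityBRunRowsAtRecordR13SepCoPHV_of_ceilingKeyedRung1VWWithRowMassRuns
    (hprod : ∀ F : T4Family, Inhabited13 F →
      ∃ (θ : Node00.Stage13HParams F 2) (h : θ.Provisos₁₃SepCoPH F 2) (v : Node00.Revision₁₃ F 2 θ h), (θ.ZhUnity F 2 ∧ θ.SlotsNondegenerate₁₃ F 2) ∧ θ.Admissible F 2 ∧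
        (∀ c : ℝ, ∃ w : WorldP, c ≤ w.βup ∧ RecordSV F θ h v w ∧ ∀ P : B12.RunParams, (leavesP w P).smallCouplings → Nodes (leavesP w P)) ∧
        ∃ (γ L s s' : ℝ) (Λ : ℕ → ℕ → ℝ), HistLipschitz Λ γ (Node00.betaOfRecord₁₃ F 2 θ.toStage13Params) ∧ (∀ k, ∑ i : Fin (k + 1), |Λ k i| ≤ L) ∧ 0 < γ ∧ 0 < s ∧
          ∀ K : ℕ, ∃ r : ℕ → ℝ, RGEqH K (Node00.betaOfRecord₁₃ F 2 θ.toStage13Params) r ∧ Step.InInterval γ K r ∧ Step.Discrete031 s s' K (r K) r) :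
    StabilityBRunRowsAtRecordR13SepCoPHV :=
  stabilityBRunRowsAtRecordR13SepCoPHV_byName_of_rowsContWitnessVW fun F hinh => by
    obtain ⟨θ, hP, v, hU, hθ, hfamW, γ, L, s, s', Λ, hL, hM, hγ, hs, hruns⟩ := hprod F hinh
    exact runRowsContAtSomeRecord13PWSVW_of_ceilingKeyedRung1VW_rowMassRuns θ hP v hU hθ hfamW hL hM hγ hs hruns

end Summit.QuantumFields.YangMills.Theorems.BalabanUVNodesK2CornerRoadLine2WK19

end
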